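import Summits.MatrixMultiplication.MatrixMultiplication.Theses.GelfandPairHosts
import Summits.MatrixMultiplication.MatrixMultiplication.Theorems.GelfandPairHostsRankFormula
import Summits.MatrixMultiplication.MatrixMultiplication.Theorems.GelfandPairHostsKillGlue
import Summits.MatrixMultiplication.MatrixMultiplication.Theorems.GelfandHosting.Negative.DesignCounting

/-!
# Strategist companion — crux `GelfandHosting` (stmt-MatrixMultiplication-7381)

Typed companion of `Cruxes/GelfandHosting/STRATEGY-CENSUS.md` (crux-strategist seat
planner-cstrat-stmt-MatrixMultiplication-7381-h1-0, 2026-08-17).  Everything here is `sorry`-free.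

* §0 Frame: `HostingExponent`, `crux_iff`, `hostingExponent_mono`, `hostingExponent_three`,
  `summit_of_crux` (the crux decides the summit: `closes` + landed `RankFormula`).
* §D: `Amplification`, `crux_of_amplification` — the ε-split is not a decomposition (BC2 (c)).
* §S: `QuotientFormHosting`, `design_of_quotientForm`, `crux_of_quotientFormHosting` — S⁺ → crux.
* §N-a: `NoNearPerfectDesigns` (NNPD, the exact residual ¬crux in exponent coordinates),
  `not_crux_of_noNearPerfectDesigns : NNPD → ¬ GelfandHosting`, its converse
  `noNearPerfectDesigns_of_not_crux` and `noNearPerfectDesigns_iff_not_crux` (§N-a′, placed after §N-c).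
* §N-b: the block–coset capacity theorem `capacity_block` / `capacity_le_of_blockStructure` for
  quotient-form designs, with corollaries `capacity_le_card_mul_index_sq` (any abelian subgroup:
  `N·[G:A]²` — AffineCapacity without regularity) and `capacity_le_card_mul_blocks_sq` (abelian block
  actions: `N·|W|²`); `affineCapacity_of_blockStructure` re-derives the route item stmt-7387.
* §N-c/d: the conjectured exact law `SquareLaw` (`abc·N ≤ D²`) with `rigidity_of_squareLaw` and
  `not_crux_of_squareLaw` (PROVED implications), and the two typed open pieces of the refutation,
  `ThetaStructure` and `RowStabiliserReduction` (claims, not proved here).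

Notation: `N = |X|`, `P_g` the permutation matrix `(P_g) y x = [g • x = y]`, `D = dim span {P_g}`;
a module-TPP design `(φ, ψ, χ)` of shape `(a,b,c)`: `φ(i,j) • ψ(j',k) = χ(i',k') ↔ (i,j,k) = (i',j',k')`;
a quotient-form design `(F, Hs ⊆ G, P ⊆ X)`: `(f'⁻¹ f h⁻¹ h') • p = p' → f = f' ∧ h = h' ∧ p = p'`.
-/

set_option linter.dupNamespace false

namespace Summit.MatrixMultiplication.MatrixMultiplication.Cruxes.GelfandHosting.Strategist

open Summit.MatrixMultiplication.MatrixMultiplication.Theses.GelfandPairHosts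
open Summit.MatrixMultiplication.MatrixMultiplication.Theorems

/-! ## §0 Frame -/

/-- `HostingExponent τ`: some multiplicity-free host carries a module-TPP design of size `abc ≥ 2`
with `D(G,X) ≤ (abc)^{τ/3}` — the `∃`-body of the crux at exponent `τ`. -/
def HostingExponent (τ : ℝ) : Prop :=
  ∃ (G : Type) (_ : Group G) (_ : Fintype G) (X : Type) (_ : Fintype X) (_ : DecidableEq X)
    (_ : MulAction G X) (a b c : ℕ) (φ : Fin a × Fin b → G) (ψ : Fin b × Fin c → X)
    (χ : Fin a × Fin c → X),
    (∀ A B : Matrix X X ℂ, (∀ (g : G) (x y : X), A (g • x) (g • y) = A x y) →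
      (∀ (g : G) (x y : X), B (g • x) (g • y) = B x y) → A * B = B * A) ∧ 2 ≤ a * b * c ∧
    (∀ (i i' : Fin a) (j j' : Fin b) (k k' : Fin c),
      φ (i, j) • ψ (j', k) = χ (i', k') ↔ (i = i' ∧ j = j' ∧ k = k')) ∧
    (Module.finrank ℂ (Submodule.span ℂ (Set.range fun g : G => Matrix.of fun y x : X =>
      if g • x = y then (1 : ℂ) else 0)) : ℝ) ≤ ((a * b * c : ℕ) : ℝ) ^ (τ / 3)

/-- The crux is literally `∀ ε > 0, HostingExponent (2 + ε)`. -/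
theorem crux_iff : GelfandHosting ↔ ∀ ε : ℝ, 0 < ε → HostingExponent (2 + ε) := Iff.rfl

/-- Hosting exponents are upward closed (`abc ≥ 2 > 1`). -/
theorem hostingExponent_mono {τ τ' : ℝ} (hle : τ ≤ τ') (h : HostingExponent τ) :
    HostingExponent τ' := by
  obtain ⟨G, iG, iFG, X, iFX, iDX, iMA, a, b, c, φ, ψ, χ, hmf, habc, hdes, hD⟩ := h
  refine ⟨G, iG, iFG, X, iFX, iDX, iMA, a, b, c, φ, ψ, χ, hmf, habc, hdes, hD.trans ?_⟩
  have h1 : (1 : ℝ) ≤ ((a * b * c : ℕ) : ℝ) := by exact_mod_cast (le_trans (by norm_num) habc)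
  exact Real.rpow_le_rpow_of_exponent_le h1 (by linarith)

/-- The exponent-`3` endpoint is attained (refuter's `body_at_one`: `Perm (Fin 2) ↷ Fin 2`). -/
theorem hostingExponent_three : HostingExponent 3 := by
  obtain ⟨G, iG, iFG, X, iFX, iDX, iMA, a, b, c, φ, ψ, χ, hmf, habc, hdes, hD⟩ :=
    GelfandHosting.Negative.body_at_one
  refine ⟨G, iG, iFG, X, iFX, iDX, iMA, a, b, c, φ, ψ, χ, hmf, habc, hdes, ?_⟩
  have e : ((2 : ℝ) + 1) / 3 = (3 : ℝ) / 3 := by norm_num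
  rw [← e]; exact hD

/-- REDUCTION audit: the crux decides the summit (`closes` fed with the landed `RankFormula`). -/
theorem summit_of_crux (h : GelfandHosting) : MatrixMultiplication := closes h rankFormula_proof

/-! ## §D  The ε-split is not a decomposition -/

/-- `Amplification`: hosting exponents are downward closed above `2`. -/
def Amplification : Prop :=
  ∀ τ τ' : ℝ, 2 < τ' → τ' ≤ τ → HostingExponent τ → HostingExponent τ'

/-- In the split `HostingExponent 3 ∧ Amplification → crux` the amplification piece alone carries the
crux, because `HostingExponent 3` is a theorem: BC2 (c) fails for this cut. -/
theorem crux_of_amplification (hA : Amplification) : GelfandHosting := by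
  rw [crux_iff]
  intro ε hε
  rcases le_or_gt (2 + ε) 3 with h | h
  · exact hA 3 (2 + ε) (by linarith) h hostingExponent_three
  · exact hostingExponent_mono h.le hostingExponent_three

/-! ## §S  Quotient-form hosting (the natural rigid subclass) implies the crux -/

/-- `QuotientFormHosting` (S⁺): the crux witnessed by designs of QUOTIENT FORM `(F, Hs ⊆ G, P ⊆ X)`:
`(f'⁻¹ f h⁻¹ h') • p = p' ⇒ f = f' ∧ h = h' ∧ p = p'`, size `|F|·|Hs|·|P|`. -/
def QuotientFormHosting : Prop :=
  ∀ ε : ℝ, 0 < ε → ∃ (G : Type) (_ : Group G) (_ : Fintype G) (X : Type) (_ : Fintype X)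
    (_ : DecidableEq X) (_ : MulAction G X) (F Hs : Finset G) (P : Finset X),
    (∀ A B : Matrix X X ℂ, (∀ (g : G) (x y : X), A (g • x) (g • y) = A x y) →
      (∀ (g : G) (x y : X), B (g • x) (g • y) = B x y) → A * B = B * A) ∧
    2 ≤ F.card * Hs.card * P.card ∧
    (∀ f ∈ F, ∀ f' ∈ F, ∀ h ∈ Hs, ∀ h' ∈ Hs, ∀ p ∈ P, ∀ p' ∈ P,
      (f'⁻¹ * f * h⁻¹ * h') • p = p' → f = f' ∧ h = h' ∧ p = p') ∧
    (Module.finrank ℂ (Submodule.span ℂ (Set.range fun g : G => Matrix.of fun y x : X =>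
      if g • x = y then (1 : ℂ) else 0)) : ℝ) ≤ ((F.card * Hs.card * P.card : ℕ) : ℝ) ^ ((2 + ε) / 3)

/-- Quotient-form designs are module-TPP designs of size `(|F|, |Hs|, |P|)`: enumerate and put
`φ(i,j) = f_i h_j⁻¹`, `ψ(j,k) = h_j • p_k`, `χ(i,k) = f_i • p_k`. [folklore] -/
theorem design_of_quotientForm {G : Type*} [Group G] {X : Type*} [MulAction G X]
    (F Hs : Finset G) (P : Finset X)
    (hdes : ∀ f ∈ F, ∀ f' ∈ F, ∀ h ∈ Hs, ∀ h' ∈ Hs, ∀ p ∈ P, ∀ p' ∈ P,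
      (f'⁻¹ * f * h⁻¹ * h') • p = p' → f = f' ∧ h = h' ∧ p = p') :
    ∃ (φ : Fin F.card × Fin Hs.card → G) (ψ : Fin Hs.card × Fin P.card → X)
      (χ : Fin F.card × Fin P.card → X),
      ∀ (i i' : Fin F.card) (j j' : Fin Hs.card) (k k' : Fin P.card),
        φ (i, j) • ψ (j', k) = χ (i', k') ↔ (i = i' ∧ j = j' ∧ k = k') := by
  classical
  let f : Fin F.card → G := fun i => ((F.equivFin.symm i : F) : G)
  let h : Fin Hs.card → G := fun j => ((Hs.equivFin.symm j : Hs) : G)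
  let p : Fin P.card → X := fun k => ((P.equivFin.symm k : P) : X)
  have hf : ∀ i, f i ∈ F := fun i => (F.equivFin.symm i).2
  have hh : ∀ j, h j ∈ Hs := fun j => (Hs.equivFin.symm j).2
  have hp : ∀ k, p k ∈ P := fun k => (P.equivFin.symm k).2
  have finj : Function.Injective f := fun i i' e =>
    F.equivFin.symm.injective (Subtype.val_injective e)
  have hinj : Function.Injective h := fun j j' e =>
    Hs.equivFin.symm.injective (Subtype.val_injective e)
  have pinj : Function.Injective p := fun k k' e =>
    P.equivFin.symm.injective (Subtype.val_injective e)
  refine ⟨fun ij => f ij.1 * (h ij.2)⁻¹, fun jk => h jk.1 • p jk.2, fun ik => f ik.1 • p ik.2, ?_⟩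
  intro i i' j j' k k'
  constructor
  · intro hyp
    have h1 : ((f i')⁻¹ * (f i * (h j)⁻¹ * h j')) • p k = p k' := by
      rw [mul_smul, mul_smul, hyp, inv_smul_smul]
    have h2 : ((f i')⁻¹ * f i * (h j)⁻¹ * h j') • p k = p k' := by
      rw [← h1]; congr 1; group
    obtain ⟨e1, e2, e3⟩ := hdes (f i) (hf i) (f i') (hf i') (h j) (hh j) (h j') (hh j') (p k) (hp k)
      (p k') (hp k') h2
    exact ⟨finj e1, hinj e2, pinj e3⟩
  · rintro ⟨rfl, rfl, rfl⟩
    show (f i * (h j)⁻¹) • h j • p k = f i • p k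
    rw [mul_smul, inv_smul_smul]

/-- `S⁺ → crux`: quotient-form hosting implies Gelfand hosting (sizes `a, b, c = |F|, |Hs|, |P|`). -/
theorem crux_of_quotientFormHosting (h : QuotientFormHosting) : GelfandHosting := by
  intro ε hε
  obtain ⟨G, iG, iFG, X, iFX, iDX, iMA, F, Hs, P, hmf, h2, hdes, hD⟩ := h ε hε
  obtain ⟨φ, ψ, χ, hd⟩ := design_of_quotientForm F Hs P hdes
  exact ⟨G, iG, iFG, X, iFX, iDX, iMA, F.card, Hs.card, P.card, φ, ψ, χ, hmf, h2, hd, hD⟩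

/-! ## §N  The exact residual: a δ-deficit for near-linear hosts refutes the crux -/

/-- `NoNearPerfectDesigns` (NNPD): there are `δ, η > 0` such that in every multiplicity-free host with
`D ≤ N^{1+η}` every module-TPP design has `abc ≤ N^{3/2-δ}`.  Strictly weaker than `GelfandRigidity`
(uniform exponent `C`) and than `¬SuperlinearCapacity`; it is `¬GelfandHosting` in exponent
coordinates. -/
def NoNearPerfectDesigns : Prop :=
  ∃ δ : ℝ, 0 < δ ∧ ∃ η : ℝ, 0 < η ∧ ∀ (G : Type) [Group G] [Fintype G] (X : Type) [Fintype X]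
    [DecidableEq X] [MulAction G X] (a b c : ℕ) (φ : Fin a × Fin b → G) (ψ : Fin b × Fin c → X)
    (χ : Fin a × Fin c → X),
    (∀ A B : Matrix X X ℂ, (∀ (g : G) (x y : X), A (g • x) (g • y) = A x y) →
      (∀ (g : G) (x y : X), B (g • x) (g • y) = B x y) → A * B = B * A) →
    (∀ (i i' : Fin a) (j j' : Fin b) (k k' : Fin c),
      φ (i, j) • ψ (j', k) = χ (i', k') ↔ (i = i' ∧ j = j' ∧ k = k')) →
    (Module.finrank ℂ (Submodule.span ℂ (Set.range fun g : G => Matrix.of fun y x : X =>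
      if g • x = y then (1 : ℂ) else 0)) : ℝ) ≤ (Fintype.card X : ℝ) ^ (1 + η) →
    ((a * b * c : ℕ) : ℝ) ≤ (Fintype.card X : ℝ) ^ (3 / 2 - δ)

/-- **NNPD refutes the crux.**  Test hosting at `ε = min δ (η/(3+η))`: if the witness host is
near-linear (`D ≤ N^{1+η}`) then NNPD caps `abc ≤ N^{3/2-δ}` while `N ≤ D ≤ (abc)^{(2+ε)/3}`, absurd
for `ε ≤ δ`; otherwise `N^{1+η} < D` and the capacity bounds `bc, ac ≤ N`, `ab ≤ D` give
`(abc)² ≤ N²D < D^{(3+η)/(1+η)}`, contradicting `D ≤ (abc)^{(2+ε)/3}` for `ε(3+η) ≤ η`. [folklore] -/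
theorem not_crux_of_noNearPerfectDesigns (hN : NoNearPerfectDesigns) : ¬ GelfandHosting := by
  intro hX
  obtain ⟨δ, hδ, η, hη, H⟩ := hN
  have h3η : (0 : ℝ) < 3 + η := by linarith
  set ε : ℝ := min δ (η / (3 + η)) with hε
  have hεpos : 0 < ε := lt_min hδ (div_pos hη h3η)
  have hεδ : ε ≤ δ := min_le_left _ _
  have hεη : ε * (3 + η) ≤ η := by
    have hle : ε ≤ η / (3 + η) := min_le_right _ _
    calc ε * (3 + η) ≤ η / (3 + η) * (3 + η) := by gcongr
      _ = η := div_mul_cancel₀ η h3η.ne'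
  obtain ⟨G, iG, iFG, X, iFX, iDX, iMA, a, b, c, φ, ψ, χ, hmf, habc, hdes, hD⟩ := hX ε hεpos
  -- the dichotomy: NNPD applies, or the host is not near-linear
  have hdisj : ((a * b * c : ℕ) : ℝ) ≤ (Fintype.card X : ℝ) ^ (3 / 2 - δ) ∨
      (Fintype.card X : ℝ) ^ (1 + η) < (Module.finrank ℂ (Submodule.span ℂ (Set.range
        fun g : G => Matrix.of fun y x : X => if g • x = y then (1 : ℂ) else 0)) : ℝ) := by
    by_cases hcase : (Module.finrank ℂ (Submodule.span ℂ (Set.range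
        fun g : G => Matrix.of fun y x : X => if g • x = y then (1 : ℂ) else 0)) : ℝ)
        ≤ (Fintype.card X : ℝ) ^ (1 + η)
    · exact Or.inl (H G X a b c φ ψ χ hmf hdes hcase)
    · exact Or.inr (not_le.mp hcase)
  -- `a, b, c ≥ 1`
  have ha : 0 < a := Nat.pos_of_ne_zero fun h => by simp [h] at habc
  have hb : 0 < b := Nat.pos_of_ne_zero fun h => by simp [h] at habc
  have hc : 0 < c := Nat.pos_of_ne_zero fun h => by simp [h] at habc
  -- capacity and cost bounds (in `ℕ`)
  have hbc := killGlue_bc_le_card φ ψ χ ⟨0, ha⟩ hdes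
  have hac := killGlue_ac_le_card φ ψ χ ⟨0, hb⟩ hdes
  have hab := killGlue_ab_le_finrank φ ψ χ ⟨0, hc⟩ hdes
  have htrans : ∀ x y : X, ∃ g : G, g • x = y := killGlue_transitive_of_comm hmf
  have hND := killGlue_card_le_finrank (G := G) (ψ (⟨0, hb⟩, ⟨0, hc⟩)) htrans
  set D : ℕ := Module.finrank ℂ (Submodule.span ℂ (Set.range fun g : G =>
      Matrix.of fun y x : X => if g • x = y then (1 : ℂ) else 0)) with hDdef
  set N : ℕ := Fintype.card X with hNdef
  -- `N ≥ 2`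
  have hN2 : 2 ≤ N := by
    by_contra hlt
    have hN1 : N ≤ 1 := by omega
    have hbc1 : b * c ≤ 1 := hbc.trans hN1
    have hac1 : a * c ≤ 1 := hac.trans hN1
    have hc1 : c = 1 := by nlinarith
    subst hc1
    have hb1 : b = 1 := by nlinarith
    have ha1 : a = 1 := by nlinarith
    subst hb1 ha1
    norm_num at habc
  -- reals
  have haR : (1 : ℝ) ≤ a := by exact_mod_cast ha
  have hbR : (1 : ℝ) ≤ b := by exact_mod_cast hb
  have hcR : (1 : ℝ) ≤ c := by exact_mod_cast hc
  have hbcR : (b : ℝ) * c ≤ N := by exact_mod_cast hbc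
  have hacR : (a : ℝ) * c ≤ N := by exact_mod_cast hac
  have habR : (a : ℝ) * b ≤ D := by exact_mod_cast hab
  have hNDR : (N : ℝ) ≤ D := by exact_mod_cast hND
  have hN2R : (2 : ℝ) ≤ N := by exact_mod_cast hN2
  have hNpos : (0 : ℝ) < N := by linarith
  have hDpos : (0 : ℝ) < D := lt_of_lt_of_le hNpos hNDR
  have hnR : ((a * b * c : ℕ) : ℝ) = (a : ℝ) * b * c := by push_cast; ring
  have hn2 : (2 : ℝ) ≤ (a : ℝ) * b * c := by rw [← hnR]; exact_mod_cast habc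
  have hnpos : (0 : ℝ) < (a : ℝ) * b * c := by linarith
  -- logs
  have hxsplit : Real.log ((a : ℝ) * b * c) = Real.log a + Real.log b + Real.log c := by
    rw [Real.log_mul (by positivity) (by positivity), Real.log_mul (by positivity) (by positivity)]
  have hxpos : 0 < Real.log ((a : ℝ) * b * c) := Real.log_pos (by linarith)
  have hLNpos : 0 < Real.log (N : ℝ) := Real.log_pos (by linarith)
  have h1 : Real.log b + Real.log c ≤ Real.log N := by
    rw [← Real.log_mul (by positivity) (by positivity)]
    exact Real.log_le_log (by positivity) hbcR
  have h2 : Real.log a + Real.log c ≤ Real.log N := by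
    rw [← Real.log_mul (by positivity) (by positivity)]
    exact Real.log_le_log (by positivity) hacR
  have h3 : Real.log a + Real.log b ≤ Real.log D := by
    rw [← Real.log_mul (by positivity) (by positivity)]
    exact Real.log_le_log (by positivity) habR
  have h4 : Real.log N ≤ Real.log D := Real.log_le_log hNpos hNDR
  have h5 : Real.log D ≤ (2 + ε) / 3 * Real.log ((a : ℝ) * b * c) := by
    rw [hnR] at hD
    have := Real.log_le_log hDpos hD
    rwa [Real.log_rpow hnpos] at this
  -- abbreviate
  set x := Real.log ((a : ℝ) * b * c) with hxdef
  set LN := Real.log (N : ℝ) with hLNdef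
  set LD := Real.log (D : ℝ) with hLDdef
  rcases hdisj with hcap | hlt
  · -- near-linear host: NNPD caps the design
    have hxcap : x ≤ (3 / 2 - δ) * LN := by
      rw [hnR] at hcap
      have := Real.log_le_log hnpos hcap
      rwa [Real.log_rpow hNpos] at this
    have k1 : LN ≤ (2 + ε) / 3 * x := h4.trans h5
    -- LN ≤ (2+ε)/3 (3/2-δ) LN, i.e. (2δ/3 - ε/2 + εδ/3) LN ≤ 0, impossible
    have m1 : (2 + ε) / 3 * x ≤ (2 + ε) / 3 * ((3 / 2 - δ) * LN) :=
      mul_le_mul_of_nonneg_left hxcap (by linarith)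
    have m2 : ε * LN ≤ δ * LN := mul_le_mul_of_nonneg_right hεδ hLNpos.le
    linarith only [k1, m1, m2, mul_pos hδ hLNpos, mul_pos (mul_pos hεpos hδ) hLNpos]
  · -- far-from-linear host: counting alone
    have hlog : LN + η * LN < LD := by
      have := Real.log_lt_log (Real.rpow_pos_of_pos hNpos _) hlt
      rw [Real.log_rpow hNpos] at this
      linarith [this, show (1 + η) * LN = LN + η * LN from by ring]
    have k2 : 2 * x ≤ 2 * LN + LD := by linarith
    -- 2x(1+η) ≤ (2LN + LD)(1+η) < 2 LD + LD (1+η) = LD (3+η)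
    have k3 : 2 * x + η * (2 * x) < 3 * LD + η * LD := by
      have m3 : η * (2 * x) ≤ η * (2 * LN + LD) := mul_le_mul_of_nonneg_left k2 hη.le
      linarith only [m3, hlog, k2]
    -- LD (3+η) ≤ (2+ε)/3 x (3+η)
    have k4 : 3 * LD + η * LD ≤ (2 + ε) / 3 * x * (3 + η) := by
      have := mul_le_mul_of_nonneg_right h5 h3η.le
      linarith [this, show LD * (3 + η) = 3 * LD + η * LD from by ring]
    -- hence 2(1+η) x < (2+ε)(3+η)/3 x, i.e. 4η x < ε(3+η) x ≤ η x: absurd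
    have k5 : ε * (3 + η) * x ≤ η * x := mul_le_mul_of_nonneg_right hεη hxpos.le
    linarith only [k3, k4, k5, mul_pos hη hxpos]


/-! ## §N1  The block–coset capacity theorem (quotient-form designs) -/

section Capacity

variable {G : Type*} [Group G] {X : Type*} [Fintype X] [DecidableEq X] [MulAction G X]
variable {W : Type*} [Fintype W] [DecidableEq W]

/-- **Block–coset capacity, one block.**  `β : X → W` is a `G`-invariant block map; `p₀` a point;
`A ≤ G` a subgroup fixing the block `B = β⁻¹(β p₀)` and acting on it commutatively; `T` a finite set
of representatives such that every `g` stabilising `B` lies in `T·A`.  Then every quotient-form design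
`(F, Hs, P)` has `|F|·|Hs|·|P ∩ B| ≤ (|W|·|T|)²·|B|`.  Injection
`(f, h, p) ↦ (block of f•p₀, block of h•p₀, rep of e f, rep of e h, ((e₂ h)⁻¹ e₂ f) • p)`. [folklore] -/
theorem capacity_block (β : X → W)
    (hβ : ∀ (g : G) (x y : X), β x = β y → β (g • x) = β (g • y))
    (p₀ : X) (A : Subgroup G) (T : Finset G)
    (hT : ∀ g : G, β (g • p₀) = β p₀ → ∃ t ∈ T, t⁻¹ * g ∈ A)
    (hA : ∀ a ∈ A, β (a • p₀) = β p₀)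
    (hcomm : ∀ a ∈ A, ∀ a' ∈ A, ∀ x : X, β x = β p₀ → a • a' • x = a' • a • x)
    (F Hs : Finset G) (P : Finset X)
    (hdes : ∀ f ∈ F, ∀ f' ∈ F, ∀ h ∈ Hs, ∀ h' ∈ Hs, ∀ p ∈ P, ∀ p' ∈ P,
      (f'⁻¹ * f * h⁻¹ * h') • p = p' → f = f' ∧ h = h' ∧ p = p') :
    F.card * Hs.card * (P.filter fun p => β p = β p₀).card
      ≤ (Fintype.card W * T.card) ^ 2 * (Finset.univ.filter fun x : X => β x = β p₀).card := by
  classical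
  -- a section over the blocks reachable from `p₀`
  let s : W → G := fun w => if h : ∃ g : G, β (g • p₀) = w then h.choose else 1
  have hs : ∀ g : G, β (s (β (g • p₀)) • p₀) = β (g • p₀) := by
    intro g
    have h : ∃ g' : G, β (g' • p₀) = β (g • p₀) := ⟨g, rfl⟩
    show β ((if h : ∃ g' : G, β (g' • p₀) = β (g • p₀) then h.choose else 1) • p₀) = β (g • p₀)
    rw [dif_pos h]
    exact h.choose_spec
  -- first normalisation: `e g` stabilises the block of `p₀`
  let e : G → G := fun g => (s (β (g • p₀)))⁻¹ * g
  have he : ∀ g : G, β (e g • p₀) = β p₀ := by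
    intro g
    have h1 := hβ (s (β (g • p₀)))⁻¹ (g • p₀) (s (β (g • p₀)) • p₀) (hs g).symm
    rw [inv_smul_smul] at h1
    simpa [e, mul_smul] using h1
  have hee : ∀ g g' : G, β (g • p₀) = β (g' • p₀) → (e g')⁻¹ * e g = g'⁻¹ * g := by
    intro g g' hgg
    simp only [e, hgg, mul_inv_rev, inv_inv]
    group
  -- second normalisation: coset representative in `T`
  have hrep : ∀ g : G, ∃ t : G, (β (g • p₀) = β p₀ → t ∈ T ∧ t⁻¹ * g ∈ A) := by
    intro g
    by_cases hg : β (g • p₀) = β p₀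
    · obtain ⟨t, ht, hta⟩ := hT g hg
      exact ⟨t, fun _ => ⟨ht, hta⟩⟩
    · exact ⟨1, fun h => absurd h hg⟩
  choose ρ hρ using hrep
  let e₂ : G → G := fun g => (ρ (e g))⁻¹ * e g
  have hρT : ∀ g : G, ρ (e g) ∈ T := fun g => (hρ (e g) (he g)).1
  have he₂A : ∀ g : G, e₂ g ∈ A := fun g => (hρ (e g) (he g)).2
  have he₂e : ∀ g g' : G, β (g • p₀) = β (g' • p₀) → ρ (e g) = ρ (e g') →
      (e₂ g')⁻¹ * e₂ g = g'⁻¹ * g := by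
    intro g g' hgg hρρ
    rw [← hee g g' hgg]
    simp only [e₂, hρρ, mul_inv_rev, inv_inv]
    group
  -- points of the block stay in the block under `A`
  have hblkA : ∀ a ∈ A, ∀ x : X, β x = β p₀ → β (a • x) = β p₀ := by
    intro a ha x hx
    rw [hβ a x p₀ hx, hA a ha]
  -- the injection
  let Φ : G × G × X → W × W × G × G × X := fun t =>
    (β (t.1 • p₀), β (t.2.1 • p₀), ρ (e t.1), ρ (e t.2.1), ((e₂ t.2.1)⁻¹ * e₂ t.1) • t.2.2)
  set PB := P.filter fun p => β p = β p₀ with hPB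
  set B := Finset.univ.filter fun x : X => β x = β p₀ with hB
  have hinj : Set.InjOn Φ ↑(F ×ˢ (Hs ×ˢ PB)) := by
    rintro ⟨f, h, p⟩ hm ⟨f', h', p'⟩ hm' heq
    simp only [Finset.coe_product, Set.mem_prod, Finset.mem_coe, hPB, Finset.mem_filter] at hm hm'
    obtain ⟨hf, hh, hp, hpB⟩ := hm
    obtain ⟨hf', hh', hp', hp'B⟩ := hm'
    simp only [Φ, Prod.mk.injEq] at heq
    obtain ⟨e1, e2, e3, e4, e5⟩ := heq
    -- the four `A`-elements
    have u1 : (e₂ f')⁻¹ ∈ A := A.inv_mem (he₂A f')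
    have u2 : e₂ h' ∈ A := he₂A h'
    have u3 : (e₂ h)⁻¹ ∈ A := A.inv_mem (he₂A h)
    have u4 : e₂ f ∈ A := he₂A f
    -- from `e5`: `p' = ((e₂ f')⁻¹ * e₂ h' * (e₂ h)⁻¹ * e₂ f) • p`
    have h5 : ((e₂ f')⁻¹ * (e₂ h' * ((e₂ h)⁻¹ * e₂ f))) • p = p' := by
      have h5a : ((e₂ h')⁻¹ * e₂ f')⁻¹ • (((e₂ h)⁻¹ * e₂ f) • p) = p' := by
        rw [e5, inv_smul_smul]
      rw [← h5a, ← mul_smul]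
      congr 1
      group
    -- commute the middle: `u₂ (u₃ (u₄ p)) = u₄ (u₃ (u₂ p))` inside the block
    have hmid : (e₂ h' * ((e₂ h)⁻¹ * e₂ f)) • p = (e₂ f * ((e₂ h)⁻¹ * e₂ h')) • p := by
      have s1 : e₂ h' • (e₂ h)⁻¹ • (e₂ f • p) = (e₂ h)⁻¹ • e₂ h' • (e₂ f • p) :=
        hcomm _ u2 _ u3 _ (hblkA _ u4 _ hpB)
      have s2 : e₂ h' • (e₂ f • p) = e₂ f • (e₂ h' • p) := hcomm _ u2 _ u4 _ hpB
      have s3 : (e₂ h)⁻¹ • e₂ f • (e₂ h' • p) = e₂ f • (e₂ h)⁻¹ • (e₂ h' • p) :=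
        hcomm _ u3 _ u4 _ (hblkA _ u2 _ hpB)
      simp only [mul_smul]
      rw [s1, s2, s3]
    have h6 : ((e₂ f')⁻¹ * (e₂ f * ((e₂ h)⁻¹ * e₂ h'))) • p = p' := by
      rw [mul_smul, ← hmid, ← mul_smul, h5]
    have h6' : ((e₂ f')⁻¹ * e₂ f * ((e₂ h)⁻¹ * e₂ h')) • p = p' := by
      rw [← h6]; congr 1; group
    rw [he₂e f f' e1 e3, he₂e h' h e2.symm e4.symm] at h6'
    have h7 : (f'⁻¹ * f * h⁻¹ * h') • p = p' := by
      rw [← h6']; congr 1; group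
    obtain ⟨r1, r2, r3⟩ := hdes f hf f' hf' h hh h' hh' p hp p' hp' h7
    subst r1 r2 r3
    rfl
  -- the image lies in `W × W × T × T × B`
  have himg : (F ×ˢ (Hs ×ˢ PB)).image Φ ⊆
      Finset.univ ×ˢ (Finset.univ ×ˢ (T ×ˢ (T ×ˢ B))) := by
    intro v hv
    rw [Finset.mem_image] at hv
    obtain ⟨⟨f, h, p⟩, hm, rfl⟩ := hv
    simp only [Finset.mem_product, hPB, Finset.mem_filter] at hm
    obtain ⟨-, -, -, hpB⟩ := hm
    simp only [Φ, Finset.mem_product, Finset.mem_univ, true_and, hB, Finset.mem_filter]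
    refine ⟨hρT f, hρT h, ?_⟩
    rw [mul_smul]
    exact hblkA _ (A.inv_mem (he₂A h)) _ (hblkA _ (he₂A f) _ hpB)
  calc F.card * Hs.card * PB.card
      = (F ×ˢ (Hs ×ˢ PB)).card := by rw [Finset.card_product, Finset.card_product, mul_assoc]
    _ = ((F ×ˢ (Hs ×ˢ PB)).image Φ).card := (Finset.card_image_of_injOn hinj).symm
    _ ≤ (Finset.univ ×ˢ (Finset.univ ×ˢ (T ×ˢ (T ×ˢ B))) : Finset (W × W × G × G × X)).card :=
        Finset.card_le_card himg
    _ = (Fintype.card W * T.card) ^ 2 * B.card := by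
        simp only [Finset.card_product, Finset.card_univ]; ring


/-- **Block–coset capacity theorem.**  If every block `B = β⁻¹(w)` of a `G`-invariant block map
`β : X → W` carries a subgroup `A_B ≤ G` fixing `B`, acting on it commutatively, and of index `≤ ι`
in the setwise stabiliser of `B` (witnessed by `≤ ι` coset representatives), then every quotient-form
design has `|F|·|Hs|·|P| ≤ |X|·(|W|·ι)²`.  `W = Unit`: the abelian-index bound `N·[G:A]²`
(AffineCapacity, stmt-7387, regularity dropped); `ι = 1`: the abelian-block bound `N·|W|²`
(parabolic / transvection / fibred hosts). [folklore] -/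
theorem capacity_le_of_blockStructure (β : X → W)
    (hβ : ∀ (g : G) (x y : X), β x = β y → β (g • x) = β (g • y)) (ι : ℕ)
    (hstr : ∀ p₀ : X, ∃ (A : Subgroup G) (T : Finset G), T.card ≤ ι ∧
      (∀ g : G, β (g • p₀) = β p₀ → ∃ t ∈ T, t⁻¹ * g ∈ A) ∧
      (∀ a ∈ A, β (a • p₀) = β p₀) ∧
      (∀ a ∈ A, ∀ a' ∈ A, ∀ x : X, β x = β p₀ → a • a' • x = a' • a • x))
    (F Hs : Finset G) (P : Finset X)
    (hdes : ∀ f ∈ F, ∀ f' ∈ F, ∀ h ∈ Hs, ∀ h' ∈ Hs, ∀ p ∈ P, ∀ p' ∈ P,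
      (f'⁻¹ * f * h⁻¹ * h') • p = p' → f = f' ∧ h = h' ∧ p = p') :
    F.card * Hs.card * P.card ≤ Fintype.card X * (Fintype.card W * ι) ^ 2 := by
  classical
  have hP : P.card = ∑ w : W, (P.filter fun p => β p = w).card :=
    Finset.card_eq_sum_card_fiberwise (f := β) (fun x _ => by simp)
  have hX : Fintype.card X = ∑ w : W, (Finset.univ.filter fun x : X => β x = w).card := by
    rw [← Finset.card_univ]
    exact Finset.card_eq_sum_card_fiberwise (f := β) (fun x _ => by simp)
  have key : ∀ w : W, F.card * Hs.card * (P.filter fun p => β p = w).card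
      ≤ (Fintype.card W * ι) ^ 2 * (Finset.univ.filter fun x : X => β x = w).card := by
    intro w
    by_cases hw : ∃ x : X, β x = w
    · obtain ⟨x₀, rfl⟩ := hw
      obtain ⟨A, T, hTι, hT, hA, hcomm⟩ := hstr x₀
      calc F.card * Hs.card * (P.filter fun p => β p = β x₀).card
          ≤ (Fintype.card W * T.card) ^ 2 * (Finset.univ.filter fun x : X => β x = β x₀).card :=
            capacity_block β hβ x₀ A T hT hA hcomm F Hs P hdes
        _ ≤ (Fintype.card W * ι) ^ 2 * (Finset.univ.filter fun x : X => β x = β x₀).card := by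
            gcongr
    · have h0 : (P.filter fun p => β p = w) = ∅ :=
        Finset.filter_eq_empty_iff.mpr fun p _ hp => hw ⟨p, hp⟩
      simp [h0]
  calc F.card * Hs.card * P.card
      = ∑ w : W, F.card * Hs.card * (P.filter fun p => β p = w).card := by rw [hP, Finset.mul_sum]
    _ ≤ ∑ w : W, (Fintype.card W * ι) ^ 2 * (Finset.univ.filter fun x : X => β x = w).card :=
        Finset.sum_le_sum fun w _ => key w
    _ = (Fintype.card W * ι) ^ 2 * ∑ w : W, (Finset.univ.filter fun x : X => β x = w).card := by
        rw [Finset.mul_sum]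
    _ = Fintype.card X * (Fintype.card W * ι) ^ 2 := by rw [← hX]; ring

/-- **Abelian-index capacity** (the tree's `AffineCapacity`, stmt-7387, with the unused regularity
hypothesis removed and the statement made index-only): for ANY abelian subgroup `A ≤ G` every
quotient-form design has `|F|·|Hs|·|P| ≤ |X|·[G:A]²`. [folklore] -/
theorem capacity_le_card_mul_index_sq [Fintype G] (A : Subgroup G)
    (hAcomm : ∀ a ∈ A, ∀ a' ∈ A, a * a' = a' * a)
    (F Hs : Finset G) (P : Finset X)
    (hdes : ∀ f ∈ F, ∀ f' ∈ F, ∀ h ∈ Hs, ∀ h' ∈ Hs, ∀ p ∈ P, ∀ p' ∈ P,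
      (f'⁻¹ * f * h⁻¹ * h') • p = p' → f = f' ∧ h = h' ∧ p = p') :
    F.card * Hs.card * P.card ≤ Fintype.card X * A.index ^ 2 := by
  classical
  haveI : Fintype (G ⧸ A) := Fintype.ofFinite (G ⧸ A)
  -- coset representatives
  let T : Finset G := Finset.univ.image fun q : G ⧸ A => q.out
  have hTcard : T.card ≤ A.index := by
    calc T.card ≤ (Finset.univ : Finset (G ⧸ A)).card := Finset.card_image_le
      _ = A.index := by rw [Finset.card_univ, Subgroup.index, Nat.card_eq_fintype_card]
  have hT : ∀ g : G, ∃ t ∈ T, t⁻¹ * g ∈ A := by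
    intro g
    refine ⟨(QuotientGroup.mk g : G ⧸ A).out, Finset.mem_image.mpr ⟨_, Finset.mem_univ _, rfl⟩, ?_⟩
    rw [← QuotientGroup.eq, QuotientGroup.out_eq']
  have h := capacity_le_of_blockStructure (W := Unit) (fun _ : X => ()) (fun _ _ _ _ => rfl)
    A.index (fun p₀ => ⟨A, T, hTcard, fun g _ => hT g, fun _ _ => rfl,
      fun a ha a' ha' x _ => by rw [← mul_smul, ← mul_smul, hAcomm a ha a' ha']⟩) F Hs P hdes
  simpa using h

/-- The setwise stabiliser of the block of `p₀` under a `G`-invariant block map. [folklore] -/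
def blockStab (β : X → W) (hβ : ∀ (g : G) (x y : X), β x = β y → β (g • x) = β (g • y))
    (p₀ : X) : Subgroup G where
  carrier := {g | β (g • p₀) = β p₀}
  one_mem' := by simp
  mul_mem' := by
    intro a b ha hb
    simp only [Set.mem_setOf_eq] at ha hb ⊢
    rw [mul_smul, hβ a (b • p₀) p₀ hb, ha]
  inv_mem' := by
    intro a ha
    simp only [Set.mem_setOf_eq] at ha ⊢
    have := hβ a⁻¹ (a • p₀) p₀ ha
    rw [inv_smul_smul] at this
    exact this.symm

/-- **Abelian-block capacity**: if the setwise stabiliser of every block of a `G`-invariant block map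
`β : X → W` acts on its block commutatively, every quotient-form design has
`|F|·|Hs|·|P| ≤ |X|·|W|²` (no abelian subgroup of small index is needed — cf. the parabolic hosts of
the census, where the least index of an abelian subgroup is superpolynomial in `|X|`). [folklore] -/
theorem capacity_le_card_mul_blocks_sq (β : X → W)
    (hβ : ∀ (g : G) (x y : X), β x = β y → β (g • x) = β (g • y))
    (hab : ∀ (g g' : G) (x : X), β (g • x) = β x → β (g' • x) = β x → g • g' • x = g' • g • x)
    (F Hs : Finset G) (P : Finset X)
    (hdes : ∀ f ∈ F, ∀ f' ∈ F, ∀ h ∈ Hs, ∀ h' ∈ Hs, ∀ p ∈ P, ∀ p' ∈ P,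
      (f'⁻¹ * f * h⁻¹ * h') • p = p' → f = f' ∧ h = h' ∧ p = p') :
    F.card * Hs.card * P.card ≤ Fintype.card X * Fintype.card W ^ 2 := by
  classical
  have h := capacity_le_of_blockStructure β hβ 1 (fun p₀ => ⟨blockStab β hβ p₀, {1}, by simp,
      fun g hg => ⟨1, Finset.mem_singleton_self _, by simpa [blockStab] using hg⟩,
      fun a ha => ha, fun a ha a' ha' x hx => ?_⟩) F Hs P hdes
  · simpa using h
  · have hax : β (a • x) = β x := by rw [hβ a x p₀ hx, show β (a • p₀) = β p₀ from ha, hx]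
    have ha'x : β (a' • x) = β x := by rw [hβ a' x p₀ hx, show β (a' • p₀) = β p₀ from ha', hx]
    exact hab a a' x hax ha'x

end Capacity



/-- The route item `AffineCapacity` (stmt-7387) re-derived from the block–coset theorem (its regularity
hypothesis is simply dropped). -/
theorem affineCapacity_of_blockStructure : AffineCapacity :=
  fun _ _ _ _ _ _ _ A F Hs P hcomm _ hdes => capacity_le_card_mul_index_sq A hcomm F Hs P hdes

/-! ## §N-c  The conjectured exact law and its consequences -/

/-- `SquareLaw` (conjectured exact form of rigidity, C = 2 with constant 1; asymptotically attained by
CKSU 2005's wreath-product triples read as module designs): in every multiplicity-free host every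
module-TPP design has `abc · N ≤ D²`. -/
def SquareLaw : Prop :=
  ∀ (G : Type) [Group G] [Fintype G] (X : Type) [Fintype X] [DecidableEq X] [MulAction G X]
    (a b c : ℕ) (φ : Fin a × Fin b → G) (ψ : Fin b × Fin c → X) (χ : Fin a × Fin c → X),
    (∀ A B : Matrix X X ℂ, (∀ (g : G) (x y : X), A (g • x) (g • y) = A x y) →
      (∀ (g : G) (x y : X), B (g • x) (g • y) = B x y) → A * B = B * A) →
    (∀ (i i' : Fin a) (j j' : Fin b) (k k' : Fin c),
      φ (i, j) • ψ (j', k) = χ (i', k') ↔ (i = i' ∧ j = j' ∧ k = k')) →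
    a * b * c * Fintype.card X ≤ Module.finrank ℂ (Submodule.span ℂ (Set.range fun g : G =>
      Matrix.of fun y x : X => if g • x = y then (1 : ℂ) else 0)) ^ 2

/-- `SquareLaw → GelfandRigidity` (take `C = 2`). -/
theorem rigidity_of_squareLaw (h : SquareLaw) : GelfandRigidity := by
  refine ⟨2, ?_⟩
  intro G _ _ X _ _ _ a b c φ ψ χ hmf hdes
  have key := h G X a b c φ ψ χ hmf hdes
  have keyR : ((a * b * c : ℕ) : ℝ) * (Fintype.card X : ℝ) ≤
      (Module.finrank ℂ (Submodule.span ℂ (Set.range fun g : G =>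
        Matrix.of fun y x : X => if g • x = y then (1 : ℂ) else 0)) : ℝ) ^ (2 : ℕ) := by
    exact_mod_cast key
  rw [Real.rpow_two, Real.rpow_two]
  have hN : (0 : ℝ) ≤ (Fintype.card X : ℝ) := Nat.cast_nonneg _
  calc ((a * b * c : ℕ) : ℝ) * (Fintype.card X : ℝ) ^ 2
      = (((a * b * c : ℕ) : ℝ) * (Fintype.card X : ℝ)) * (Fintype.card X : ℝ) := by ring
    _ ≤ (Module.finrank ℂ (Submodule.span ℂ (Set.range fun g : G =>
        Matrix.of fun y x : X => if g • x = y then (1 : ℂ) else 0)) : ℝ) ^ (2 : ℕ) *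
        (Fintype.card X : ℝ) := mul_le_mul_of_nonneg_right keyR hN
    _ = (Fintype.card X : ℝ) * (Module.finrank ℂ (Submodule.span ℂ (Set.range fun g : G =>
        Matrix.of fun y x : X => if g • x = y then (1 : ℂ) else 0)) : ℝ) ^ 2 := by ring

/-- `SquareLaw → ¬ GelfandHosting` (through the landed KillGlue). -/
theorem not_crux_of_squareLaw (h : SquareLaw) : ¬ GelfandHosting :=
  killGlue_proof (rigidity_of_squareLaw h)

/-! ## §N-a′  NNPD is exactly the negation of the crux -/

/-- **The converse: `¬ GelfandHosting → NNPD`.**  If hosting fails at `ε₀` (w.l.o.g. `ε₀ ≤ 1`, by upward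
closure), put `η = ε₀/4`, `δ = 3ε₀/(4(2+ε₀))`; a near-linear host with a design of size `abc > N^{3/2-δ}`
would witness `HostingExponent (2+ε₀)` because `(1+η)/(3/2-δ) = (2+ε₀)/3`.  Hence NNPD is EXACTLY
`¬ GelfandHosting` in exponent coordinates. [folklore] -/
theorem noNearPerfectDesigns_of_not_crux (h : ¬ GelfandHosting) : NoNearPerfectDesigns := by
  classical
  -- a failing exponent `ε₁ > 0`, and w.l.o.g. `ε₀ = min ε₁ 1 ≤ 1`
  have hnall : ¬ ∀ ε : ℝ, 0 < ε → HostingExponent (2 + ε) := fun hall => h (crux_iff.mpr hall)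
  obtain ⟨ε₁, hε₁⟩ := not_forall.mp hnall
  obtain ⟨hε₁pos, hno₁⟩ := Classical.not_imp.mp hε₁
  set ε₀ : ℝ := min ε₁ 1 with hε₀def
  have hε₀ : 0 < ε₀ := lt_min hε₁pos one_pos
  have hε₀1 : ε₀ ≤ 1 := min_le_right _ _
  have hno : ¬ HostingExponent (2 + ε₀) := fun hh =>
    hno₁ (hostingExponent_mono (by linarith [min_le_left ε₁ 1]) hh)
  have h2ε : (0 : ℝ) < 2 + ε₀ := by linarith
  refine ⟨3 * ε₀ / (4 * (2 + ε₀)), by positivity, ε₀ / 4, by positivity, ?_⟩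
  intro G iG iFG X iFX iDX iMA a b c φ ψ χ hmf hdes hD
  have hγpos : (0 : ℝ) < 3 / 2 - 3 * ε₀ / (4 * (2 + ε₀)) := by
    have : 3 * ε₀ / (4 * (2 + ε₀)) ≤ 1 / 2 := by
      rw [div_le_iff₀ (by positivity)]; nlinarith
    linarith
  have hexp : 1 / (3 / 2 - 3 * ε₀ / (4 * (2 + ε₀))) * (1 + ε₀ / 4) = (2 + ε₀) / 3 := by
    have h2ne : (2 : ℝ) + ε₀ ≠ 0 := ne_of_gt h2ε
    rw [one_div, inv_mul_eq_div, div_eq_iff hγpos.ne']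
    field_simp
    ring
  by_contra hgt0
  have hgt := not_le.mp hgt0
  -- `hgt : N^(3/2-δ) < abc`; we derive `HostingExponent (2+ε₀)` from this very host
  apply hno
  have hN0 : (0 : ℝ) ≤ (Fintype.card X : ℝ) := Nat.cast_nonneg _
  have habc0 : (0 : ℝ) ≤ ((a * b * c : ℕ) : ℝ) := Nat.cast_nonneg _
  have habcpos : (0 : ℝ) < ((a * b * c : ℕ) : ℝ) :=
    lt_of_le_of_lt (Real.rpow_nonneg hN0 _) hgt
  have habcposN : 0 < a * b * c := by exact_mod_cast habcpos
  have ha : 0 < a := Nat.pos_of_ne_zero fun h0 => by simp [h0] at habcposN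
  have hb : 0 < b := Nat.pos_of_ne_zero fun h0 => by simp [h0] at habcposN
  have hc : 0 < c := Nat.pos_of_ne_zero fun h0 => by simp [h0] at habcposN
  have hbc := killGlue_bc_le_card φ ψ χ ⟨0, ha⟩ hdes
  have hac := killGlue_ac_le_card φ ψ χ ⟨0, hb⟩ hdes
  -- `N ≥ 2`
  have hN1 : 1 ≤ Fintype.card X := le_trans (Nat.mul_pos hb hc) hbc
  have hN2 : 2 ≤ Fintype.card X := by
    by_contra hlt
    have hN1' : Fintype.card X = 1 := by omega
    have hbc1 : b * c ≤ 1 := hN1' ▸ hbc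
    have hac1 : a * c ≤ 1 := hN1' ▸ hac
    have hc1 : c = 1 := by nlinarith
    subst hc1
    have hb1 : b = 1 := by nlinarith
    have ha1 : a = 1 := by nlinarith
    subst hb1 ha1
    rw [hN1'] at hgt
    norm_num at hgt
  have hN2R : (2 : ℝ) ≤ Fintype.card X := by exact_mod_cast hN2
  -- `2 ≤ abc`
  have h2abc : 2 ≤ a * b * c := by
    have h1 : (Fintype.card X : ℝ) ^ (1 : ℝ) ≤
        (Fintype.card X : ℝ) ^ (3 / 2 - 3 * ε₀ / (4 * (2 + ε₀))) := by
      apply Real.rpow_le_rpow_of_exponent_le (by linarith)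
      have : 3 * ε₀ / (4 * (2 + ε₀)) ≤ 1 / 2 := by
        rw [div_le_iff₀ (by positivity)]; nlinarith
      linarith
    rw [Real.rpow_one] at h1
    have : (2 : ℝ) < ((a * b * c : ℕ) : ℝ) := by linarith
    exact_mod_cast this.le
  -- `D ≤ (abc)^((2+ε₀)/3)`
  have hNlt : (Fintype.card X : ℝ) ≤
      ((a * b * c : ℕ) : ℝ) ^ (1 / (3 / 2 - 3 * ε₀ / (4 * (2 + ε₀)))) := by
    have h1 := Real.rpow_le_rpow (Real.rpow_nonneg hN0 _) hgt.le (le_of_lt (one_div_pos.mpr hγpos))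
    rwa [← Real.rpow_mul hN0, mul_one_div_cancel hγpos.ne', Real.rpow_one] at h1
  have hcost : (Module.finrank ℂ (Submodule.span ℂ (Set.range fun g : G =>
      Matrix.of fun y x : X => if g • x = y then (1 : ℂ) else 0)) : ℝ) ≤
      ((a * b * c : ℕ) : ℝ) ^ ((2 + ε₀) / 3) := by
    calc _ ≤ (Fintype.card X : ℝ) ^ (1 + ε₀ / 4) := hD
      _ ≤ (((a * b * c : ℕ) : ℝ) ^ (1 / (3 / 2 - 3 * ε₀ / (4 * (2 + ε₀))))) ^ (1 + ε₀ / 4) :=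
          Real.rpow_le_rpow hN0 hNlt (by positivity)
      _ = ((a * b * c : ℕ) : ℝ) ^ ((2 + ε₀) / 3) := by
          rw [← Real.rpow_mul habc0, hexp]
  refine ⟨G, iG, iFG, X, iFX, iDX, iMA, a, b, c, φ, ψ, χ, hmf, h2abc, hdes, ?_⟩
  exact hcost

/-- Hence the equivalence: NNPD is exactly the negation of the crux. -/
theorem noNearPerfectDesigns_iff_not_crux : NoNearPerfectDesigns ↔ ¬ GelfandHosting :=
  ⟨not_crux_of_noNearPerfectDesigns, noNearPerfectDesigns_of_not_crux⟩


/-! ## §N-d  The two open pieces of the refutation, typed (claims, not proved here) -/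

/-- `ThetaStructure` (OPEN; the structure half of NNPD for quotient-form designs): there are `C, γ > 0`
such that every multiplicity-free host of near-linear cost `D ≤ N^{1+γ}` admits block–coset data as in
`capacity_le_of_blockStructure` of total size `|W|·ι ≤ (D/N)^C`.  Evidence: affine-parabolic, wreath,
USP, dihedral and transvection hosts (θ = D/N or less); the index-only and blocks-only versions are
false (parabolic hosts; dihedral hosts of prime degree). -/
def ThetaStructure : Prop :=
  ∃ C : ℝ, 0 < C ∧ ∃ γ : ℝ, 0 < γ ∧ ∀ (G : Type) [Group G] [Fintype G] (X : Type) [Fintype X]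
    [DecidableEq X] [MulAction G X],
    (∀ A B : Matrix X X ℂ, (∀ (g : G) (x y : X), A (g • x) (g • y) = A x y) →
      (∀ (g : G) (x y : X), B (g • x) (g • y) = B x y) → A * B = B * A) →
    (Module.finrank ℂ (Submodule.span ℂ (Set.range fun g : G => Matrix.of fun y x : X =>
      if g • x = y then (1 : ℂ) else 0)) : ℝ) ≤ (Fintype.card X : ℝ) ^ (1 + γ) →
    ∃ (W : Type) (_ : Fintype W) (β : X → W) (ι : ℕ),
      (∀ (g : G) (x y : X), β x = β y → β (g • x) = β (g • y)) ∧
      (∀ p₀ : X, ∃ (A : Subgroup G) (T : Finset G), T.card ≤ ι ∧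
        (∀ g : G, β (g • p₀) = β p₀ → ∃ t ∈ T, t⁻¹ * g ∈ A) ∧
        (∀ a ∈ A, β (a • p₀) = β p₀) ∧
        (∀ a ∈ A, ∀ a' ∈ A, ∀ x : X, β x = β p₀ → a • a' • x = a' • a • x)) ∧
      ((Fintype.card W * ι : ℕ) : ℝ) ≤ ((Module.finrank ℂ (Submodule.span ℂ (Set.range fun g : G =>
        Matrix.of fun y x : X => if g • x = y then (1 : ℂ) else 0)) : ℝ) / Fintype.card X) ^ C

/-- `RowStabiliserReduction` (TRUE, provable-now, M-sized; sharpening the refuter's Frobenius lemma):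
if the pointwise stabiliser of every ψ-row of a module-TPP design is trivial, the design is of
quotient form — `φ(i,j) = f_i h_j⁻¹`, `ψ(j,k) = h_j • p_k`, `χ(i,k) = f_i • p_k` with
`f_i = φ(i,j₀)`, `h_j = φ(i₀,j)⁻¹ φ(i₀,j₀)`, `p_k = ψ(j₀,k)`. -/
def RowStabiliserReduction : Prop :=
  ∀ (G : Type) [Group G] (X : Type) [MulAction G X] (a b c : ℕ) (φ : Fin a × Fin b → G)
    (ψ : Fin b × Fin c → X) (χ : Fin a × Fin c → X) (i₀ : Fin a) (j₀ : Fin b),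
    (∀ (i i' : Fin a) (j j' : Fin b) (k k' : Fin c),
      φ (i, j) • ψ (j', k) = χ (i', k') ↔ (i = i' ∧ j = j' ∧ k = k')) →
    (∀ (j : Fin b) (g : G), (∀ k : Fin c, g • ψ (j, k) = ψ (j, k)) → g = 1) →
    ∀ (i : Fin a) (j : Fin b) (k : Fin c),
      φ (i, j) = φ (i, j₀) * (φ (i₀, j₀))⁻¹ * φ (i₀, j) ∧
      ψ (j, k) = ((φ (i₀, j))⁻¹ * φ (i₀, j₀)) • ψ (j₀, k) ∧
      χ (i, k) = φ (i, j₀) • ψ (j₀, k)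

end Summit.MatrixMultiplication.MatrixMultiplication.Cruxes.GelfandHosting.Strategist
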